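/-
Copyright (c) 2026 the pub-hodgecm-mathlib formalisation cell (harness21).  R90-TF SLAB, section S10 (Rogawski 1990, Ch. 13.5–13.8 comparison engine read at `v`),
typist R90-C138-typ4 (g0) — FILE C2 (DEFS), COMPANION MODULE «PINNED READ-OFFS» (pen R90-C131-p03 (g0), module boundary only); h413 = `stmt-HodgeConjecture-24833`, route `HCCMUnconditional`.
-/
import Summits.HodgeConjecture.HodgeConjecture.Theorems.R90S10FrozenDatumDefs                     -- ★ FILE C2: `S10HDatum`, `S10Frozen`, `S10GCutCore`, `S10GCut`, `S10FrozenDatum`, `MatchE1`, `S10MemG`, carriers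
import HarnessLib

/-!
# R90-TF ∕ S10 — FILE C2, COMPANION: the PINNED READ-OFFS of the frozen datum of (13.8.3)
# (`Theorems/R90S10FrozenDatumPinned.lean`; ns `Summit.HodgeConjecture.HodgeConjecture.R90.S10`)

This module is `section Pinned` of typ4's FILE C2 candidate `R90S10FrozenDatumDefs.lean` (sha16 9c494f31126bd38d, :696–:753) VERBATIM — every declaration
byte-identical, same namespace, same names; it was split off at the module boundary only because the gate lint `lint.statement-form` caps a Theorems file
WITH proofs at 400 lines (the defs module, statement-only, may have 1000).  Contents (FILE A ∕ LINES B read these BY NAME):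
* `S10GCutCore.cl i := [P i]`, `S10GCutCore.loc i w := [ρc i w]` (DEFINED local classes, audit (B-d));
* `S10Frozen.hsplitH_two` — READ-OFF (B1_H)+(B2_H) with `aH = 2`: `Σ_j m_j · Tr ρ_j(ΦH f^H) = 2 · Tr ρ^∞(f^H ⊗ 𝟙_{K_H^v})` for matched pairs (the former socket A2b, CLOSED BY
  NAME from `S10HDatum.hpacki`) [Rogawski1990, §13.8 p. 218 L22, L26, p. 219 L1–L2; FlathCorvallis1979, Thm. 3];
* `S10GCutCore.hocc` (members occur in the discrete spectrum, ★ `cmOccursInDiscreteSpectrum_iff`), `S10GCutCore.hloc` (the `v`-factor has the character of `loc i v`,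
  `rfl`), `S10GCutCore.memG` (every member satisfies THE membership predicate `S10MemG`, audit R1) [Rogawski1990, §13.3 p. 199 ¶2; §13.8 p. 219 L3].
CONSUMERS: LINES B (`import …Theorems.R90S10FrozenDatumPinned`, head uses `𝔣.𝔳.hsplitH_two`), FILE A (through B).
HONEST LABEL: two definitions + four read-off theorems over FILE C2's structures; 0 `sorry`; closes nothing; HC_CM is proved only modulo the 7 printed citations
(2 remaining named inputs: hLiu418 = `stmt-HodgeConjecture-24832`, h413 = `stmt-HodgeConjecture-24833`) until rung 0 closes; REL ≠ ★ ≠ BUILT.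
-/

set_option autoImplicit false
set_option linter.dupNamespace false

noncomputable section

open scoped RestrictedProduct Matrix MatrixGroups
open Filter MeasureTheory NumberField IsDedekindDomain CompactlySupported
open Literature.NumberTheory.Rogawski1990 Literature.NumberTheory.Automorphic Literature.NumberTheory.Automorphic.UnitaryGroup
open Literature.NumberTheory.Automorphic.UnitaryGroup.CotangentForms Literature.NumberTheory.GaloisRepresentations
open Literature.NumberTheory.Automorphic.Arthur2013.Leaves.TECR
open Summit.HodgeConjecture.HodgeConjecture.Cruxes.H413.F0P3GlobalPacketDiscrete (cmOccursInDiscreteSpectrum cmOccursInDiscreteSpectrum_iff)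
open Summit.HodgeConjecture.HodgeConjecture.Cruxes.H413.K2E1TraceFormulaBeta
open Summit.HodgeConjecture.HodgeConjecture.Cruxes.H413.K2E1SpectralTermsDiscreteHalf
open Summit.HodgeConjecture.HodgeConjecture.Cruxes.H413.K2E1bGKCohomologyU21.U8 (HasArchOpTrace)

namespace Summit.HodgeConjecture.HodgeConjecture.R90.S10

section Pinned

variable {L : Type} [Field L] [NumberField L] [IsCMField L] [DecidableEq (Pl L)] {μ : HeckeCharacter L} {v : Pl L}
  [MeasurableSpace (HLoc L v)] [BorelSpace (HLoc L v)] [MeasurableSpace (Gqs L v)] [BorelSpace (Gqs L v)]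
  {νHv : Measure (HLoc L v)} {νQv : Measure (Gqs L v)} [νHv.IsHaarMeasure] [νHv.IsMulRightInvariant] [νQv.IsHaarMeasure] [νQv.IsMulRightInvariant]
  [∀ a : HLoc L v, MeasurableSpace (HLoc L v ⧸ Subgroup.centralizer ({a} : Set (HLoc L v)))]
  [∀ a : HLoc L v, BorelSpace (HLoc L v ⧸ Subgroup.centralizer ({a} : Set (HLoc L v)))]
  [∀ γ : Gqs L v, MeasurableSpace (Gqs L v ⧸ Subgroup.centralizer ({γ} : Set (Gqs L v)))]
  [∀ γ : Gqs L v, BorelSpace (Gqs L v ⧸ Subgroup.centralizer ({γ} : Set (Gqs L v)))]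
  {mHv : OrbitalMeasureFamily (HLoc L v)} {mQv : OrbitalMeasureFamily (Gqs L v)} {πSt : IrrClass (HLoc L v)}
  [MeasurableSpace (G3 L).Adelic] [BorelSpace (G3 L).Adelic] [MeasurableSpace (H2 L).Adelic] [BorelSpace (H2 L).Adelic]
  [MeasurableSpace (GArch L)] [BorelSpace (GArch L)] [MeasurableSpace (HArch L)] [BorelSpace (HArch L)]
  [MeasurableSpace (H1Loc L v)] [MeasurableSpace (H1Arch L)] [MeasurableSpace (H1 L).Adelic] [BorelSpace (H1 L).Adelic]

/-- The members as discrete classes: `cl i := [P i]`. [cite: Rogawski1990, §13.8 (13.8.3) p. 218 L5] -/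
def S10GCutCore.cl {𝔥 : S10HDatum L μ v νHv νQv mHv mQv πSt} {𝔳 : S10Frozen L μ v νHv νQv mHv mQv πSt 𝔥}
    (𝔤 : S10GCutCore L μ v νHv νQv mHv mQv πSt 𝔥 𝔳) (i : 𝔤.ι) : haveI := 𝔤.hμG; DiscreteClass (G3 L) 𝔤.μG :=
  haveI := 𝔤.hμG; DiscreteClass.mk (𝔤.P i)

/-- The members' local classes: `loc i w := [ρc i w]` (DEFINED, audit (B-d)). [cite: Rogawski1990, §13.8 p. 219 L1–L3] [cite: FlathCorvallis1979, Thm. 3] -/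
def S10GCutCore.loc {𝔥 : S10HDatum L μ v νHv νQv mHv mQv πSt} {𝔳 : S10Frozen L μ v νHv νQv mHv mQv πSt 𝔥}
    (𝔤 : S10GCutCore L μ v νHv νQv mHv mQv πSt 𝔥 𝔳) (i : 𝔤.ι) (w : Pl L) : IrrClass (Gqs L w) :=
  IrrClass.mk { V := 𝔤.Vc i w, instAddCommGroup := 𝔤.acVc i w, instModule := 𝔤.mdVc i w, ρ := 𝔤.ρc i w, isIrreducible := 𝔤.hirrc i w, isSmooth := 𝔤.hsmc i w }

omit [MeasurableSpace (G3 L).Adelic] [BorelSpace (G3 L).Adelic] in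
/-- **READ-OFF (B1_H) + (B2_H) WITH `aH = 2`** — the ARCH–FIN SPLIT on `H` at the frozen vector, in SUM form over the packet cut (AUDIT S10#5 F6): for matched pairs
`Σ_j m_j · Tr ρ_j(ΦH f^H) = 2 · Tr ρ^∞(f^H ⊗ 𝟙_{K_H^v})` — `𝔥.hpacki` instantiated at the frozen `f^H_∞` (`𝔳.htrH`: packet trace `2`), its `θ_∞`-reduction `𝔳.fHi₂` and the freezing
map `𝔳.ΦH`; exactly ★ `flath_conjuncts_of_inputs_of_locSmooth`'s `hsplitH` at `trH := trHPinned 𝔣` with `aH := 2` (so the former socket A2b is CLOSED BY NAME here).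
[cite: Rogawski1990, §13.8 p. 218 L22, L26, p. 219 L1–L2] [cite: FlathCorvallis1979, Thm. 3] -/
theorem S10Frozen.hsplitH_two {𝔥 : S10HDatum L μ v νHv νQv mHv mQv πSt} (𝔳 : S10Frozen L μ v νHv νQv mHv mQv πSt 𝔥)
    (fH : HLoc L v → ℂ) (φ : Gqs L v → ℂ) (hM : MatchE1 L μ v mHv mQv fH φ) :
    (haveI := 𝔥.hμH; haveI := 𝔥.hνH; ∑ᶠ j, (((𝔥.dρ j).mult).toNat : ℂ) * (𝔥.dρ j).classTrace 𝔥.νH (𝔳.ΦH fH)) =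
      2 * (haveI := 𝔥.hKHo; @Representation.smoothTrace _ _ _ _ 𝔥.msFH _ 𝔥.acW 𝔥.mdW 𝔥.σH 𝔥.νfH (fun g : Πʳ w : Pl L, [HLoc L w, 𝔥.KH w] => fH (g v) *
        Set.indicator {g : Πʳ w : Pl L, [HLoc L w, 𝔥.KH w] | ∀ w, w ≠ v → g w ∈ 𝔥.KH w} (fun _ => (1 : ℂ)) g)) :=
  𝔥.hpacki 𝔳.fHi 2 𝔳.hsmH 𝔳.htrH 𝔳.fHi₂ 𝔳.hfHi₂ 𝔳.ΦH 𝔳.hΦH fH φ hM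

/-- READ-OFF for FILE A: every member OCCURS in the discrete spectrum with local classes `loc i` (★ `cmOccursInDiscreteSpectrum`, from the primitive witness and its links).
[cite: Rogawski1990, §13.3 p. 199 ¶2] -/
theorem S10GCutCore.hocc {𝔥 : S10HDatum L μ v νHv νQv mHv mQv πSt} {𝔳 : S10Frozen L μ v νHv νQv mHv mQv πSt 𝔥}
    (𝔤 : S10GCutCore L μ v νHv νQv mHv mQv πSt 𝔥 𝔳) (i : 𝔤.ι) :
    haveI := 𝔤.hμG; cmOccursInDiscreteSpectrum L 3 (qsForm L) 𝔤.μG (𝔤.loc i) := by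
  haveI := 𝔤.hμG
  obtain ⟨h1, h2, h3, h4⟩ := 𝔤.hσf i
  exact (cmOccursInDiscreteSpectrum_iff L 3 (qsForm L) 𝔤.μG (𝔤.loc i)).2 ⟨𝔤.P i, 𝔤.Wf i, 𝔤.acWf i, 𝔤.mdWf i, 𝔤.σf i, h1, h2, h3, 𝔤.hPσf i, h4⟩

/-- READ-OFF for FILE A: (B3) the local factor at `v` has the character of `loc i v` (definitional, ★ `IrrClass.smoothTrace_mk`). -/
theorem S10GCutCore.hloc {𝔥 : S10HDatum L μ v νHv νQv mHv mQv πSt} {𝔳 : S10Frozen L μ v νHv νQv mHv mQv πSt 𝔥}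
    (𝔤 : S10GCutCore L μ v νHv νQv mHv mQv πSt 𝔥 𝔳) (i : 𝔤.ι) :
    (𝔤.loc i v).smoothTrace νQv = @Representation.smoothTrace _ _ _ _ _ _ (𝔤.acVc i v) (𝔤.mdVc i v) (𝔤.ρc i v) νQv := rfl

/-- READ-OFF (audit R1): every member satisfies THE membership predicate `S10MemG`. [cite: Rogawski1990, §13.8 p. 219 L3] -/
theorem S10GCutCore.memG {𝔥 : S10HDatum L μ v νHv νQv mHv mQv πSt} {𝔳 : S10Frozen L μ v νHv νQv mHv mQv πSt 𝔥}
    (𝔤 : S10GCutCore L μ v νHv νQv mHv mQv πSt 𝔥 𝔳) (i : 𝔤.ι) :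
    haveI := 𝔤.hμG; S10MemG L μ v νHv νQv mHv mQv πSt 𝔥 𝔳 𝔤.μG (𝔤.cl i) (𝔤.loc i) := by
  haveI := 𝔤.hμG
  exact ⟨⟨𝔤.P i, 𝔤.Wf i, 𝔤.acWf i, 𝔤.mdWf i, 𝔤.σf i, rfl, 𝔤.hPσf i, 𝔤.hσf i⟩, fun w => 𝔤.hfib i w⟩

end Pinned

end Summit.HodgeConjecture.HodgeConjecture.R90.S10

end
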